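import Summits.QuantumFields.QCD.Theorems.EulerDescentChiralCornerSoftnessStubSlabFluxBoundBerezin
import Literature.MathematicalPhysics.QuantumFieldTheory.QCDCurrentSector
import Literature.MathematicalPhysics.QuantumLattice.GrassmannGaussianMeasureChange
import HarnessLib

/-!
# The flavour-rotation Ward operator on the torus quark algebra and the slab combinatorics (file 2/4 of stub
`stub_slabFluxBound`, line `Sketch` of crux `Summit.QuantumFields.QCD.Theses.EulerDescent.ChiralCornerSoftness`,
item stmt-QuantumFields-16902)

On the quark Grassmann algebra `FermiAlg N_f L` of `QCDOS` (the objects `quadQ`, `bilinKernel`, `wardN`, `wardOp`,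
`slabInd` are defined in `EulerDescentChiralCornerSoftnessStubSlabFluxBoundBerezin.lean`):

* `quadQ M = Σ_{v,w} M_{vw} ψ̄_v ψ_w` (`quadQ_eq_sum`), its linearity, centrality and nilpotency; the torus
  bilinears of `QCDCurrentSector` as `quadQ` of explicit kernels (`torusBilinear_eq_quadQ`);
* the **Ward operator** `wardOp B` of the infinitesimal rotation `ψ ↦ (1+εB)ψ`, `ψ̄ ↦ ψ̄(1−εB)` is a traceless
  substitution derivation (`sum_wardN_diag`): `δψ̄_v = −Σ_w B_{wv}ψ̄_w`, `δψ_v = Σ_w B_{vw}ψ_w`,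
  `δ(ψ̄Mψ) = ψ̄(MB − BM)ψ` (`wardOp_quadQ`);
* the **exact Ward identity of the Gaussian weight** `∫ (δX) e^{ψ̄Mψ} + ∫ X e^{ψ̄Mψ} ψ̄[M,B]ψ = 0`
  (`fermiIntegral_wardOp_add`) and, for a `B`-invariant insertion, `∫ X ψ̄[M,B]ψ e^{ψ̄Mψ} = 0`
  (`fermiIntegral_mul_quadQ_comm_mul_grassmannExp_eq_zero`);
* slab combinatorics on the torus of side `2S+1` (§E): the indicator `slabInd` of the slab complement
  `{s₀ ≤ x₀ ≤ 2S+1−s₀}` as a sum of slice indicators over the statement's slab finset (`slabInd_eq_sum`), its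
  discrete time derivative picking the two boundary slices (`slabInd_succ_sub`), and the bijective
  parametrisation of a time slice by the spatial box `{−S,…,S}³` (`sum_box_eq_sum_slice`).

References: I. Montvay, G. Münster, *Quantum Fields on a Lattice* (1994), §4.1 and §5.3.1 (5.146)–(5.150);
F. A. Berezin, *The Method of Second Quantization* (1966), Ch. I §3.  Everything is proved; no named fact.
-/

noncomputable section

namespace Summit.QuantumFields.QCD.Cruxes.ChiralCornerSoftness.TwistedRay

open Filter Topology MeasureTheory
open Literature.MathematicalPhysics.QuantumFieldTheory Literature.MathematicalPhysics.QuantumLattice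
  Literature.Probability.LatticeModels

namespace SlabFluxWard

open Literature.MathematicalPhysics.QuantumLattice.GrassmannAlgebra

/-! ### §B Quark-variable bookkeeping on the torus and the flavour-rotation Ward operator -/

section Torus

variable {Nf L : ℕ} [NeZero L]

/-- `quadQ M = Σ_{v,w} M_{vw} ψ̄_v ψ_w` over quark variables. [folklore] -/
theorem quadQ_eq_sum (M : Matrix (QuarkVar Nf L) (QuarkVar Nf L) ℂ) :
    quadQ M = ∑ v, ∑ w, M v w • (qbar v * q w) := by
  unfold quadQ quadratic
  rw [← Equiv.sum_comp quarkEquiv]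
  refine Finset.sum_congr rfl fun v _ => ?_
  rw [← Equiv.sum_comp quarkEquiv]
  refine Finset.sum_congr rfl fun w _ => ?_
  simp [Matrix.reindex_apply, qbar, q]

/-- `quadQ` is additive. [folklore] -/
theorem quadQ_add (M N : Matrix (QuarkVar Nf L) (QuarkVar Nf L) ℂ) : quadQ (M + N) = quadQ M + quadQ N := by
  simp only [quadQ_eq_sum, Matrix.add_apply, add_smul, Finset.sum_add_distrib]

/-- `quadQ` respects differences. [folklore] -/
theorem quadQ_sub (M N : Matrix (QuarkVar Nf L) (QuarkVar Nf L) ℂ) : quadQ (M - N) = quadQ M - quadQ N := by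
  simp only [quadQ_eq_sum, Matrix.sub_apply, sub_smul, Finset.sum_sub_distrib]

/-- `quadQ` respects negation. [folklore] -/
theorem quadQ_neg (M : Matrix (QuarkVar Nf L) (QuarkVar Nf L) ℂ) : quadQ (-M) = -quadQ M := by
  simp only [quadQ_eq_sum, Matrix.neg_apply, neg_smul, Finset.sum_neg_distrib]

/-- `quadQ` is homogeneous. [folklore] -/
theorem quadQ_smul (c : ℂ) (M : Matrix (QuarkVar Nf L) (QuarkVar Nf L) ℂ) : quadQ (c • M) = c • quadQ M := by
  simp only [quadQ_eq_sum, Matrix.smul_apply, smul_eq_mul, mul_smul, Finset.smul_sum]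

/-- `quadQ` respects finite sums. [folklore] -/
theorem quadQ_sum {α : Type*} (s : Finset α) (M : α → Matrix (QuarkVar Nf L) (QuarkVar Nf L) ℂ) :
    quadQ (∑ a ∈ s, M a) = ∑ a ∈ s, quadQ (M a) := by
  classical
  induction s using Finset.induction_on with
  | empty => simp [quadQ_eq_sum]
  | insert a s ha ih => rw [Finset.sum_insert ha, Finset.sum_insert ha, quadQ_add, ih]

/-- A quadratic action is central. [folklore] -/
theorem commute_quadQ (M : Matrix (QuarkVar Nf L) (QuarkVar Nf L) ℂ) (z : FermiAlg Nf L) : Commute (quadQ M) z :=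
  commute_quadratic ℂ _ z

/-- A quadratic action is nilpotent. [folklore] -/
theorem isNilpotent_quadQ (M : Matrix (QuarkVar Nf L) (QuarkVar Nf L) ℂ) : IsNilpotent (quadQ M) :=
  isNilpotent_quadratic ℂ _

/-- The torus bilinear with its four sums ordered colour–spin of `ψ̄` outside colour–spin of `ψ`. [folklore] -/
theorem torusBilinear_eq_sum' (f g : Fin Nf) (x y : TorusSite 4 L) (Γs : Matrix (Fin 4) (Fin 4) ℂ)
    (Mc : Matrix (Fin 3) (Fin 3) ℂ) :
    torusBilinear f g x y Γs Mc =
      ∑ a : Fin 3, ∑ α : Fin 4, ∑ b : Fin 3, ∑ β : Fin 4,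
        (Γs α β * Mc a b) • (qbar (f, (x, a, α)) * q (g, (y, b, β))) := by
  rw [torusBilinear]
  refine (Finset.sum_congr rfl fun α _ => Finset.sum_comm).trans ?_
  rw [Finset.sum_comm]
  exact Finset.sum_congr rfl fun a _ => Finset.sum_congr rfl fun α _ => Finset.sum_comm

/-- **The torus bilinear is the quadratic action of its kernel.** [folklore] -/
theorem torusBilinear_eq_quadQ (f g : Fin Nf) (x y : TorusSite 4 L) (Γs : Matrix (Fin 4) (Fin 4) ℂ)
    (Mc : Matrix (Fin 3) (Fin 3) ℂ) : torusBilinear f g x y Γs Mc = quadQ (bilinKernel f g x y Γs Mc) := by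
  rw [torusBilinear_eq_sum', quadQ_eq_sum, Fintype.sum_prod_type,
    Fintype.sum_eq_single f (fun f' hf' => by simp [bilinKernel, hf']), Fintype.sum_prod_type,
    Fintype.sum_eq_single x (fun x' hx' => by simp [bilinKernel, hx']), Fintype.sum_prod_type]
  refine Finset.sum_congr rfl fun a _ => Finset.sum_congr rfl fun α _ => ?_
  rw [Fintype.sum_prod_type, Fintype.sum_eq_single g (fun g' hg' => by simp [bilinKernel, hg']),
    Fintype.sum_prod_type, Fintype.sum_eq_single y (fun y' hy' => by simp [bilinKernel, hy']),
    Fintype.sum_prod_type]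
  simp [bilinKernel]

/-! #### The Ward operator of an infinitesimal flavour–site rotation `ψ ↦ (1+εB)ψ`, `ψ̄ ↦ ψ̄(1−εB)` -/

/-- The `ψ̄ψ̄` block of the label matrix. [folklore] -/
@[simp] theorem wardN_inl_inl (B : Matrix (QuarkVar Nf L) (QuarkVar Nf L) ℂ) (i k : FermiIdx Nf L) :
    wardN B (toLex (Sum.inl i)) (toLex (Sum.inl k)) = -B (quarkEquiv.symm i) (quarkEquiv.symm k) := rfl
/-- The `ψψ` block of the label matrix. [folklore] -/
@[simp] theorem wardN_inr_inr (B : Matrix (QuarkVar Nf L) (QuarkVar Nf L) ℂ) (i l : FermiIdx Nf L) :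
    wardN B (toLex (Sum.inr i)) (toLex (Sum.inr l)) = B (quarkEquiv.symm l) (quarkEquiv.symm i) := rfl
/-- The off-diagonal blocks of the label matrix vanish. [folklore] -/
@[simp] theorem wardN_inl_inr (B : Matrix (QuarkVar Nf L) (QuarkVar Nf L) ℂ) (i k : FermiIdx Nf L) :
    wardN B (toLex (Sum.inl i)) (toLex (Sum.inr k)) = 0 := rfl
/-- The off-diagonal blocks of the label matrix vanish. [folklore] -/
@[simp] theorem wardN_inr_inl (B : Matrix (QuarkVar Nf L) (QuarkVar Nf L) ℂ) (i k : FermiIdx Nf L) :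
    wardN B (toLex (Sum.inr i)) (toLex (Sum.inl k)) = 0 := rfl

/-- The substitution is traceless (as many `ψ̄` as `ψ` rotate, oppositely). [folklore] -/
theorem sum_wardN_diag (B : Matrix (QuarkVar Nf L) (QuarkVar Nf L) ℂ) : ∑ X, wardN B X X = 0 := by
  rw [← Fintype.sum_equiv toLex (fun w => wardN B (toLex w) (toLex w)) _ (fun _ => rfl), Fintype.sum_sum_type]
  simp

/-- The Ward operator is a derivation. [folklore] -/
theorem wardOp_mul (B : Matrix (QuarkVar Nf L) (QuarkVar Nf L) ℂ) (a b : FermiAlg Nf L) :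
    wardOp B (a * b) = wardOp B a * b + a * wardOp B b :=
  subOp_mul _ a b

/-- `δ ψ̄_v = −Σ_w B_{wv} ψ̄_w`. [folklore] -/
theorem wardOp_qbar (B : Matrix (QuarkVar Nf L) (QuarkVar Nf L) ℂ) (v : QuarkVar Nf L) :
    wardOp B (qbar v) = -∑ w, B w v • qbar w := by
  rw [wardOp, qbar, psiBar, subOp_gen, ← Fintype.sum_equiv toLex
    (fun w => wardN B (toLex w) (toLex (Sum.inl (quarkEquiv v))) • gen ℂ (toLex w)) _ (fun _ => rfl),
    Fintype.sum_sum_type]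
  simp only [wardN_inl_inl, wardN_inr_inl, zero_smul, Finset.sum_const_zero, add_zero,
    Equiv.symm_apply_apply, neg_smul, Finset.sum_neg_distrib]
  rw [← Equiv.sum_comp quarkEquiv]
  simp [qbar, psiBar]

/-- `δ ψ_v = Σ_w B_{vw} ψ_w`. [folklore] -/
theorem wardOp_q (B : Matrix (QuarkVar Nf L) (QuarkVar Nf L) ℂ) (v : QuarkVar Nf L) :
    wardOp B (q v) = ∑ w, B v w • q w := by
  rw [wardOp, q, psi, subOp_gen, ← Fintype.sum_equiv toLex
    (fun w => wardN B (toLex w) (toLex (Sum.inr (quarkEquiv v))) • gen ℂ (toLex w)) _ (fun _ => rfl),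
    Fintype.sum_sum_type]
  simp only [wardN_inr_inr, wardN_inl_inr, zero_smul, Finset.sum_const_zero, zero_add,
    Equiv.symm_apply_apply]
  rw [← Equiv.sum_comp quarkEquiv]
  simp [q, psi]

/-- The Ward operator on a monomial `ψ̄_v ψ_w`. [folklore] -/
theorem wardOp_qbar_mul_q (B : Matrix (QuarkVar Nf L) (QuarkVar Nf L) ℂ) (v w : QuarkVar Nf L) :
    wardOp B (qbar v * q w) = -(∑ u, B u v • (qbar u * q w)) + ∑ u, B w u • (qbar v * q u) := by
  rw [wardOp_mul, wardOp_qbar, wardOp_q, neg_mul, Finset.sum_mul, Finset.mul_sum]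
  simp only [smul_mul_assoc, mul_smul_comm]

/-- **The Ward operator on a quadratic action is the quadratic action of the commutator**:
`δ(ψ̄Mψ) = ψ̄(MB − BM)ψ`. [folklore] -/
theorem wardOp_quadQ (B M : Matrix (QuarkVar Nf L) (QuarkVar Nf L) ℂ) :
    wardOp B (quadQ M) = quadQ (M * B - B * M) := by
  have h1 : wardOp B (quadQ M) =
      -(∑ v, ∑ w, ∑ u, (M v w * B u v) • (qbar u * q w)) + ∑ v, ∑ w, ∑ u, (M v w * B w u) • (qbar v * q u) := by
    rw [quadQ_eq_sum]
    simp only [map_sum, map_smul, wardOp_qbar_mul_q, smul_add, smul_neg, Finset.smul_sum, smul_smul,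
      Finset.sum_add_distrib, Finset.sum_neg_distrib]
  have h2 : ∑ v, ∑ w, ∑ u, (M v w * B u v) • (qbar u * q w) =
      ∑ u : QuarkVar Nf L, ∑ w, (∑ v, B u v * M v w) • (qbar u * q w) := by
    rw [Finset.sum_comm]
    conv_lhs => arg 2; ext w; rw [Finset.sum_comm]
    rw [Finset.sum_comm]
    refine Finset.sum_congr rfl fun u _ => Finset.sum_congr rfl fun w _ => ?_
    rw [Finset.sum_smul]
    exact Finset.sum_congr rfl fun v _ => by rw [mul_comm]
  have h3 : ∑ v, ∑ w, ∑ u, (M v w * B w u) • (qbar v * q u) =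
      ∑ v : QuarkVar Nf L, ∑ u, (∑ w, M v w * B w u) • (qbar v * q u) := by
    refine Finset.sum_congr rfl fun v _ => ?_
    rw [Finset.sum_comm]
    exact Finset.sum_congr rfl fun u _ => by rw [Finset.sum_smul]
  rw [h1, h2, h3, quadQ_eq_sum]
  simp only [Matrix.sub_apply, Matrix.mul_apply, sub_smul, Finset.sum_sub_distrib]
  abel

/-- **The exact Ward identity of the rotation `B` for the Gaussian weight `e^{ψ̄Mψ}`**:
`∫ (δX) e^{ψ̄Mψ} + ∫ X e^{ψ̄Mψ} ψ̄[M,B]ψ = 0`. [folklore] -/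
theorem fermiIntegral_wardOp_add (B M : Matrix (QuarkVar Nf L) (QuarkVar Nf L) ℂ) (X : FermiAlg Nf L) :
    fermiIntegral (wardOp B X * grassmannExp (quadQ M)) +
      fermiIntegral (X * (grassmannExp (quadQ M) * quadQ (M * B - B * M))) = 0 := by
  have h := berezin_subOp_mul_grassmannExp_add (wardN B) (sum_wardN_diag B) (q := quadQ M)
    (commute_quadQ M _) (isNilpotent_quadQ M) X
  rw [← wardOp, wardOp_quadQ] at h   -- may need `show`
  exact h

/-- **Ward identity for a `B`-invariant insertion**: `δX = 0 ⟹ ∫ X ψ̄[M,B]ψ e^{ψ̄Mψ} = 0`. [folklore] -/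
theorem fermiIntegral_mul_quadQ_comm_mul_grassmannExp_eq_zero (B M : Matrix (QuarkVar Nf L) (QuarkVar Nf L) ℂ)
    {X : FermiAlg Nf L} (hX : wardOp B X = 0) :
    fermiIntegral (X * quadQ (M * B - B * M) * grassmannExp (quadQ M)) = 0 := by
  have h := fermiIntegral_wardOp_add B M X
  rwa [hX, zero_mul, map_zero, zero_add, ← (commute_quadQ (M * B - B * M) _).eq, ← mul_assoc] at h

end Torus

/-! ### §E The slab: indicator rotation, boundary slices, and the box parametrisation of time slices -/

section Slab

/-- The origin is not in the slab complement (`s₀ ≥ 1`). [folklore] -/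
theorem slabInd_zero {S s₀ : ℕ} (hs₀ : 1 ≤ s₀) : slabInd S s₀ 0 = 0 := by
  simp only [slabInd, ZMod.val_zero]
  rw [if_neg]
  omega

/-- A residue equals the class of `n < 2S+1` iff its canonical representative is `n`. [folklore] -/
theorem eq_natCast_iff_val_eq {S : ℕ} (z : ZMod (2 * S + 1)) {n : ℕ} (hn : n < 2 * S + 1) :
    z = (n : ZMod (2 * S + 1)) ↔ z.val = n := by
  constructor
  · rintro rfl; exact ZMod.val_cast_of_lt hn
  · intro h; rw [← h, ZMod.natCast_zmod_val]

/-- **The indicator as a sum of slice indicators over the slab finset of the statement.** [folklore] -/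
theorem slabInd_eq_sum {S s₀ : ℕ} (hs₀ : 1 ≤ s₀) (z : ZMod (2 * S + 1)) :
    slabInd S s₀ z = ∑ s ∈ (Finset.range (2 * S + 2)).filter (fun s => s₀ ≤ s ∧ s + s₀ ≤ 2 * S + 1),
      if z = (s : ZMod (2 * S + 1)) then (1 : ℂ) else 0 := by
  have hz := ZMod.val_lt z
  rw [Finset.sum_congr rfl (g := fun s => if z.val = s then (1 : ℂ) else 0) fun s hs => ?_]
  · rw [Finset.sum_ite_eq]
    simp only [Finset.mem_filter, Finset.mem_range, slabInd]
    split_ifs <;> first | rfl | (exfalso; omega)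
  · have hsL : s < 2 * S + 1 := by
      simp only [Finset.mem_filter, Finset.mem_range] at hs; omega
    exact if_congr (eq_natCast_iff_val_eq z hsL) rfl rfl

/-- **The discrete time derivative of the indicator**: `+1` on the slice below the slab complement,
`−1` on its top slice. [folklore] -/
theorem slabInd_succ_sub {S s₀ : ℕ} (hs₀ : 1 ≤ s₀) (hsS : s₀ ≤ S) (z : ZMod (2 * S + 1)) :
    slabInd S s₀ (z + 1) - slabInd S s₀ z =
      (if z = (((s₀ : ℤ) - 1 : ℤ) : ZMod (2 * S + 1)) then 1 else 0) -
        (if z = ((-(s₀ : ℤ) : ℤ) : ZMod (2 * S + 1)) then 1 else 0) := by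
  haveI : Fact (1 < 2 * S + 1) := ⟨by omega⟩
  have hz := ZMod.val_lt z
  have c1 : (((s₀ : ℤ) - 1 : ℤ) : ZMod (2 * S + 1)) = ((s₀ - 1 : ℕ) : ZMod (2 * S + 1)) := by
    push_cast [Nat.cast_sub hs₀]; ring
  have c2 : ((-(s₀ : ℤ) : ℤ) : ZMod (2 * S + 1)) = ((2 * S + 1 - s₀ : ℕ) : ZMod (2 * S + 1)) := by
    rw [Nat.cast_sub (by omega), ZMod.natCast_self, zero_sub]; push_cast; ring
  rw [c1, c2, if_congr (eq_natCast_iff_val_eq z (n := s₀ - 1) (by omega)) rfl rfl,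
    if_congr (eq_natCast_iff_val_eq z (n := 2 * S + 1 - s₀) (by omega)) rfl rfl]
  have hv : (z + 1).val = (z.val + 1) % (2 * S + 1) := by rw [ZMod.val_add, ZMod.val_one]
  simp only [slabInd, hv]
  rcases Nat.lt_or_ge (z.val + 1) (2 * S + 1) with hlt | hge
  · rw [Nat.mod_eq_of_lt hlt]
    split_ifs <;> norm_num <;> omega
  · have h0 : (z.val + 1) % (2 * S + 1) = 0 := by
      rw [show z.val + 1 = 2 * S + 1 by omega, Nat.mod_self]
    rw [h0]
    split_ifs <;> norm_num <;> omega

/-- **Box parametrisation of a time slice**: `y ↦ (t, y⃗) mod 2S+1` is a bijection from `{−S,…,S}³` onto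
the slice `x₀ = t` of the torus of side `2S+1`. [folklore] -/
theorem sum_box_eq_sum_slice (S : ℕ) (t : ℤ) {M : Type*} [AddCommMonoid M] (F : TorusSite 4 (2 * S + 1) → M) :
    ∑ y ∈ box 3 S, F (Torus.proj (2 * S + 1) (Matrix.vecCons t y)) =
      ∑ x ∈ Finset.univ.filter (fun x : TorusSite 4 (2 * S + 1) => x 0 = (t : ZMod (2 * S + 1))), F x := by
  refine Finset.sum_nbij' (fun y => Torus.proj (2 * S + 1) (Matrix.vecCons t y))
    (fun x => fun i => (x i.succ).valMinAbs) ?_ ?_ ?_ ?_ ?_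
  · intro y _; simp
  · intro x _
    rw [mem_box]
    intro i
    have h := ZMod.natAbs_valMinAbs_le (x i.succ)
    have hS : (2 * S + 1) / 2 = S := by omega
    omega
  · intro y hy
    rw [mem_box] at hy
    funext i
    simp only [Torus.proj_apply, Matrix.cons_val_succ]
    refine (ZMod.valMinAbs_spec _ _).2 ⟨rfl, ?_⟩
    have := hy i
    constructor <;> push_cast <;> omega
  · intro x hx
    simp only [Finset.mem_filter, Finset.mem_univ, true_and] at hx
    funext i
    refine Fin.cases ?_ (fun j => ?_) i
    · simp [hx]
    · simp [ZMod.coe_valMinAbs]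
  · intro y _; rfl

end Slab

end SlabFluxWard

/-- **Registered sub-goal of file 2/4** (`stub_slabFluxBound_ward`): the exact Ward identity of the flavour–site
rotation `B` for a `B`-invariant insertion `X` against the Gaussian Grassmann weight `e^{ψ̄Mψ}` on the torus quark
algebra — `δ_B X = 0 ⟹ ∫dψ̄dψ X · ψ̄[M,B]ψ · e^{ψ̄Mψ} = 0`. [cite: MontvayMunster1994, §5.3.1 (5.150)] -/
theorem stub_slabFluxBound_ward :
    ∀ {Nf L : ℕ} [NeZero L] (B M : Matrix (QuarkVar Nf L) (QuarkVar Nf L) ℂ) {X : FermiAlg Nf L}, SlabFluxWard.wardOp B X = 0 → fermiIntegral (X * SlabFluxWard.quadQ (M * B - B * M) * grassmannExp (SlabFluxWard.quadQ M)) = 0 :=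
  fun B M _ hX => SlabFluxWard.fermiIntegral_mul_quadQ_comm_mul_grassmannExp_eq_zero B M hX


end Summit.QuantumFields.QCD.Cruxes.ChiralCornerSoftness.TwistedRay
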